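/-
VALUE = THEOREM, NOT summit progress (cell b2b-lgcu-borel, gen 21); crux 14079 untouched.
-/
import Mathlib
import Summits.MatrixMultiplication.MatrixMultiplication.Theorems.SubgroupIdentityDesigns.Negative.PackingBridge
import Summits.MatrixMultiplication.MatrixMultiplication.Theorems.SubgroupIdentityDesigns.Negative.VectorTransportSpan

/-!
# The cyclic-index functional: a character-free split exclusion

VALUE = THEOREM (every `p`, every `m`, every `ε`), NOT summit progress.

Let `N ≤ GL_m(𝔽_p)` be a subgroup and `q ∈ GL_m(𝔽_p)`, `r ≥ 2`, such that

* (`hone`) `n q^i = 1` with `n ∈ N`, `i < r` forces `i = 0` (so `N q^0, …, N q^{r-1}` meet `1`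
  only at `(1, 0)`), and
* (`htr`, TRANSLATED ACTION) every `q^i` (`i < r`) moves every vector the way SOME element of `N`
  does: `q^i u = n_{i,u} u`.

Then the functional `Λ h = Σ_{n ∈ N} Σ_{i<r} ζ_r^i h(n q^i)` (`ζ_r = e^{2πi/r}`) kills every vector
transport `t_{u,a} : g ↦ [g u = a]` (reindex `n ↦ n n_{i,u}`: the inner count does not depend on
`i`, and `Σ_i ζ_r^i = 0`), hence all of `F₁ = levelSubmodule p m 1`
(`VectorTransportSpan.levelSubmodule_le_of_transport`); but on a function with `h(1) = 1`
vanishing at every `n q^i ≠ 1` it takes the value `1`.  Consequently (`no_design_of_split`):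

**if every `n q^i ≠ 1` (`n ∈ N`, `i < r`) is a triple product `a b c` (`a ∈ H₁, b ∈ H₂, c ∈ H₃`),
then `(H₁, H₂, H₃)` carries no level-one identity design** — in particular if `N ≤ H_a` and
`q ∈ H_b` for `a ≠ b` (`no_design_of_split₁₂/₁₃/₂₃`, and with `q` normalising `N`,
`no_design_of_split₂₁/₃₁/₃₂`).  No TPP, no volume hypothesis, no character of any group.

This is the semidirect (`K = N ⋊ ⟨q⟩`) case of factored admissibility
(`FactoredAdmissibility.lean`) with the linear character replaced by the explicit functional, so
that instances need no character theory: e.g. the SINGER–FROBENIUS split (`N` = a Singer cycle or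
its norm-one subgroup acting on `𝔽_p^m ≅ 𝔽_{p^m}`, `q` = the Frobenius, `q^i x = x^{p^i-1} · x`).

HONEST SCOPE.  Configuration exclusion; no `(p,m,ε)` cell is emptied.
-/

set_option linter.dupNamespace false

noncomputable section

open scoped BigOperators Classical Matrix

namespace Summit.MatrixMultiplication.MatrixMultiplication.Theorems.SubgroupIdentityDesigns.Negative
namespace SplitFunctional

open Summit.MatrixMultiplication.MatrixMultiplication.Theorems.LieRankDesigns.Negative (GLm Mat)
open Summit.MatrixMultiplication.MatrixMultiplication.Theorems.LevelOneGL2Designs.Negative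
  (levelSubmodule)
open PackingBridge (exists_test)
open VectorTransportSpan (levelSubmodule_le_of_transport)

variable {p m : ℕ} [hp : Fact p.Prime]

/-- The cyclic-index functional `Λ h = Σ_{n ∈ N} Σ_{i < r} ζ^i · h(n q^i)`. -/
def Lam (N : Subgroup (GLm p m)) (q : GLm p m) (r : ℕ) (ζ : ℂ) : (GLm p m → ℂ) →ₗ[ℂ] ℂ where
  toFun h := ∑ n : N, ∑ i : Fin r, ζ ^ (i : ℕ) * h ((n : GLm p m) * q ^ (i : ℕ))
  map_add' f g := by
    simp only [Pi.add_apply, mul_add, Finset.sum_add_distrib]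
  map_smul' c f := by
    simp only [Pi.smul_apply, smul_eq_mul, RingHom.id_apply, Finset.mul_sum, mul_left_comm]

/-- Unfolding `Λ`. -/
theorem Lam_apply (N : Subgroup (GLm p m)) (q : GLm p m) (r : ℕ) (ζ : ℂ) (h : GLm p m → ℂ) :
    Lam N q r ζ h = ∑ n : N, ∑ i : Fin r, ζ ^ (i : ℕ) * h ((n : GLm p m) * q ^ (i : ℕ)) := rfl

/-- Under the translated action, `Λ` kills every vector transport whenever `Σ_{i<r} ζ^i = 0`. -/
theorem Lam_transport (N : Subgroup (GLm p m)) (q : GLm p m) {r : ℕ} {ζ : ℂ}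
    (hζ : ∑ i : Fin r, ζ ^ (i : ℕ) = 0)
    (htr : ∀ i < r, ∀ u : Fin m → ZMod p, ∃ n ∈ N,
      ((q ^ i : GLm p m) : Mat p m) *ᵥ u = ((n : GLm p m) : Mat p m) *ᵥ u)
    (u a : Fin m → ZMod p) :
    Lam N q r ζ (fun g : GLm p m => if (g : Mat p m) *ᵥ u = a then (1 : ℂ) else 0) = 0 := by
  rw [Lam_apply, Finset.sum_comm]
  have key : ∀ i : Fin r,
      (∑ n : N, ζ ^ (i : ℕ) * (if (((n : GLm p m) * q ^ (i : ℕ) : GLm p m) : Mat p m) *ᵥ u = a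
        then (1 : ℂ) else 0)) =
      ζ ^ (i : ℕ) * ∑ n : N, (if ((n : GLm p m) : Mat p m) *ᵥ u = a then (1 : ℂ) else 0) := by
    intro i
    obtain ⟨n₀, hn₀, hq⟩ := htr i i.isLt u
    rw [Finset.mul_sum]
    have hre : ∀ n : N, (((n : GLm p m) * q ^ (i : ℕ) : GLm p m) : Mat p m) *ᵥ u =
        (((n * ⟨n₀, hn₀⟩ : N) : GLm p m) : Mat p m) *ᵥ u := by
      intro n
      simp only [Subgroup.coe_mul, Units.val_mul, ← Matrix.mulVec_mulVec, hq]
    simp_rw [hre]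
    exact Fintype.sum_equiv (Equiv.mulRight (⟨n₀, hn₀⟩ : N)) _ _ (fun n => rfl)
  simp_rw [key, ← Finset.sum_mul, hζ, zero_mul]

/-- On a function with `h 1 = 1` vanishing at every `n q^i ≠ 1`, `Λ` takes the value `1`. -/
theorem Lam_delta (N : Subgroup (GLm p m)) (q : GLm p m) {r : ℕ} (hr : 2 ≤ r) (ζ : ℂ)
    (hone : ∀ n ∈ N, ∀ i < r, (n : GLm p m) * q ^ i = 1 → i = 0)
    {h : GLm p m → ℂ} (h1 : h 1 = 1)
    (h0 : ∀ n ∈ N, ∀ i < r, (n : GLm p m) * q ^ i ≠ 1 → h (n * q ^ i) = 0) :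
    Lam N q r ζ h = 1 := by
  rw [Lam_apply]
  have i0 : (⟨0, by omega⟩ : Fin r) = ⟨0, by omega⟩ := rfl
  rw [Finset.sum_eq_single (1 : N)]
  · simp only [OneMemClass.coe_one]
    rw [Finset.sum_eq_single (⟨0, by omega⟩ : Fin r)]
    · simp [h1]
    · intro i _ hi
      have hne : (1 : GLm p m) * q ^ (i : ℕ) ≠ 1 := by
        intro heq
        exact hi (Fin.ext (hone 1 N.one_mem i i.isLt heq))
      rw [h0 1 N.one_mem i i.isLt hne, mul_zero]
    · intro h; exact absurd (Finset.mem_univ _) h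
  · intro n _ hn
    refine Finset.sum_eq_zero fun i _ => ?_
    have hne : (n : GLm p m) * q ^ (i : ℕ) ≠ 1 := by
      intro heq
      have hi := hone n n.2 i i.isLt heq
      rw [hi, pow_zero, mul_one] at heq
      exact hn (Subtype.ext heq)
    rw [h0 n n.2 i i.isLt hne, mul_zero]
  · intro h; exact absurd (Finset.mem_univ _) h

variable {H₁ H₂ H₃ : Subgroup (GLm p m)}

/-- **SPLIT EXCLUSION (cover form).**  `N`, `q`, `r ≥ 2` with `hone` and the translated action;
if every `n q^i ≠ 1` is a triple product then no level-one identity design. -/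
theorem no_design_of_split (N : Subgroup (GLm p m)) (q : GLm p m) {r : ℕ} (hr : 2 ≤ r)
    (hone : ∀ n ∈ N, ∀ i < r, (n : GLm p m) * q ^ i = 1 → i = 0)
    (htr : ∀ i < r, ∀ u : Fin m → ZMod p, ∃ n ∈ N,
      ((q ^ i : GLm p m) : Mat p m) *ᵥ u = ((n : GLm p m) : Mat p m) *ᵥ u)
    (hcov : ∀ n ∈ N, ∀ i < r, (n : GLm p m) * q ^ i ≠ 1 →
      ∃ a ∈ H₁, ∃ b ∈ H₂, ∃ c ∈ H₃, a * b * c = n * q ^ i) :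
    ¬ ∃ c : Mat p m → ℂ, (∀ M, 1 < M.rank → c M = 0) ∧
      (∑ M, c M * ZMod.stdAddChar (Matrix.trace (M * ((1 : GLm p m) : Mat p m)))) = 1 ∧
      ∀ a ∈ H₁, ∀ b ∈ H₂, ∀ g ∈ H₃, a * b * g ≠ 1 →
        (∑ M, c M * ZMod.stdAddChar (Matrix.trace (M * ((a * b * g : GLm p m) : Mat p m)))) = 0 := by
  intro hdes
  obtain ⟨f, hf, h1, h0⟩ := exists_test hdes
  set ζ : ℂ := Complex.exp (2 * Real.pi * Complex.I / r) with hζ_def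
  have hprim : IsPrimitiveRoot ζ r := Complex.isPrimitiveRoot_exp r (by omega)
  have hsum : ∑ i : Fin r, ζ ^ (i : ℕ) = 0 := by
    rw [Fin.sum_univ_eq_sum_range (fun i => ζ ^ i) r]
    exact hprim.geom_sum_eq_zero hr
  have hker : levelSubmodule p m 1 ≤ LinearMap.ker (Lam N q r ζ) :=
    levelSubmodule_le_of_transport fun u a => by
      rw [LinearMap.mem_ker]
      exact Lam_transport N q hsum htr u a
  have hz : Lam N q r ζ f = 0 := LinearMap.mem_ker.mp (hker hf)
  have h0' : ∀ n ∈ N, ∀ i < r, (n : GLm p m) * q ^ i ≠ 1 → f (n * q ^ i) = 0 := by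
    intro n hn i hi hne
    obtain ⟨a, ha, b, hb, c, hc, habc⟩ := hcov n hn i hi hne
    rw [← habc]
    exact h0 a ha b hb c hc (habc ▸ hne)
  have hone' := Lam_delta N q hr ζ hone h1 h0'
  rw [hz] at hone'
  exact zero_ne_one hone'

/-- `N ≤ H₁`, `q ∈ H₂`. -/
theorem no_design_of_split₁₂ (N : Subgroup (GLm p m)) (q : GLm p m) {r : ℕ} (hr : 2 ≤ r)
    (hone : ∀ n ∈ N, ∀ i < r, (n : GLm p m) * q ^ i = 1 → i = 0)
    (htr : ∀ i < r, ∀ u : Fin m → ZMod p, ∃ n ∈ N,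
      ((q ^ i : GLm p m) : Mat p m) *ᵥ u = ((n : GLm p m) : Mat p m) *ᵥ u)
    (hN : N ≤ H₁) (hq : q ∈ H₂) :
    ¬ ∃ c : Mat p m → ℂ, (∀ M, 1 < M.rank → c M = 0) ∧
      (∑ M, c M * ZMod.stdAddChar (Matrix.trace (M * ((1 : GLm p m) : Mat p m)))) = 1 ∧
      ∀ a ∈ H₁, ∀ b ∈ H₂, ∀ g ∈ H₃, a * b * g ≠ 1 →
        (∑ M, c M * ZMod.stdAddChar (Matrix.trace (M * ((a * b * g : GLm p m) : Mat p m)))) = 0 :=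
  no_design_of_split N q hr hone htr fun n hn i _ _ =>
    ⟨n, hN hn, q ^ i, H₂.pow_mem hq i, 1, H₃.one_mem, mul_one _⟩

/-- `N ≤ H₁`, `q ∈ H₃`. -/
theorem no_design_of_split₁₃ (N : Subgroup (GLm p m)) (q : GLm p m) {r : ℕ} (hr : 2 ≤ r)
    (hone : ∀ n ∈ N, ∀ i < r, (n : GLm p m) * q ^ i = 1 → i = 0)
    (htr : ∀ i < r, ∀ u : Fin m → ZMod p, ∃ n ∈ N,
      ((q ^ i : GLm p m) : Mat p m) *ᵥ u = ((n : GLm p m) : Mat p m) *ᵥ u)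
    (hN : N ≤ H₁) (hq : q ∈ H₃) :
    ¬ ∃ c : Mat p m → ℂ, (∀ M, 1 < M.rank → c M = 0) ∧
      (∑ M, c M * ZMod.stdAddChar (Matrix.trace (M * ((1 : GLm p m) : Mat p m)))) = 1 ∧
      ∀ a ∈ H₁, ∀ b ∈ H₂, ∀ g ∈ H₃, a * b * g ≠ 1 →
        (∑ M, c M * ZMod.stdAddChar (Matrix.trace (M * ((a * b * g : GLm p m) : Mat p m)))) = 0 :=
  no_design_of_split N q hr hone htr fun n hn i _ _ =>
    ⟨n, hN hn, 1, H₂.one_mem, q ^ i, H₃.pow_mem hq i, by rw [mul_one]⟩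

/-- `N ≤ H₂`, `q ∈ H₃`. -/
theorem no_design_of_split₂₃ (N : Subgroup (GLm p m)) (q : GLm p m) {r : ℕ} (hr : 2 ≤ r)
    (hone : ∀ n ∈ N, ∀ i < r, (n : GLm p m) * q ^ i = 1 → i = 0)
    (htr : ∀ i < r, ∀ u : Fin m → ZMod p, ∃ n ∈ N,
      ((q ^ i : GLm p m) : Mat p m) *ᵥ u = ((n : GLm p m) : Mat p m) *ᵥ u)
    (hN : N ≤ H₂) (hq : q ∈ H₃) :
    ¬ ∃ c : Mat p m → ℂ, (∀ M, 1 < M.rank → c M = 0) ∧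
      (∑ M, c M * ZMod.stdAddChar (Matrix.trace (M * ((1 : GLm p m) : Mat p m)))) = 1 ∧
      ∀ a ∈ H₁, ∀ b ∈ H₂, ∀ g ∈ H₃, a * b * g ≠ 1 →
        (∑ M, c M * ZMod.stdAddChar (Matrix.trace (M * ((a * b * g : GLm p m) : Mat p m)))) = 0 :=
  no_design_of_split N q hr hone htr fun n hn i _ _ =>
    ⟨1, H₁.one_mem, n, hN hn, q ^ i, H₃.pow_mem hq i, by rw [one_mul]⟩

omit hp in
/-- Reordering `n q^i = q^i · (q^{-i} n q^i)` when `q` normalises `N`. -/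
theorem conj_pow_mem {N : Subgroup (GLm p m)} {q : GLm p m} (hq : ∀ n ∈ N, q⁻¹ * n * q ∈ N)
    {n : GLm p m} (hn : n ∈ N) (i : ℕ) : (q ^ i)⁻¹ * n * q ^ i ∈ N := by
  induction i generalizing n with
  | zero => simpa using hn
  | succ i ih =>
    have h : (q ^ (i + 1))⁻¹ * n * q ^ (i + 1) = q⁻¹ * ((q ^ i)⁻¹ * n * q ^ i) * q := by
      rw [pow_succ]; group
    rw [h]
    exact hq _ (ih hn)

/-- `q ∈ H₁` normalising `N ≤ H₂`. -/
theorem no_design_of_split₂₁ (N : Subgroup (GLm p m)) (q : GLm p m) {r : ℕ} (hr : 2 ≤ r)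
    (hone : ∀ n ∈ N, ∀ i < r, (n : GLm p m) * q ^ i = 1 → i = 0)
    (htr : ∀ i < r, ∀ u : Fin m → ZMod p, ∃ n ∈ N,
      ((q ^ i : GLm p m) : Mat p m) *ᵥ u = ((n : GLm p m) : Mat p m) *ᵥ u)
    (hnorm : ∀ n ∈ N, q⁻¹ * n * q ∈ N) (hq : q ∈ H₁) (hN : N ≤ H₂) :
    ¬ ∃ c : Mat p m → ℂ, (∀ M, 1 < M.rank → c M = 0) ∧
      (∑ M, c M * ZMod.stdAddChar (Matrix.trace (M * ((1 : GLm p m) : Mat p m)))) = 1 ∧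
      ∀ a ∈ H₁, ∀ b ∈ H₂, ∀ g ∈ H₃, a * b * g ≠ 1 →
        (∑ M, c M * ZMod.stdAddChar (Matrix.trace (M * ((a * b * g : GLm p m) : Mat p m)))) = 0 :=
  no_design_of_split N q hr hone htr fun n hn i _ _ =>
    ⟨q ^ i, H₁.pow_mem hq i, (q ^ i)⁻¹ * n * q ^ i, hN (conj_pow_mem hnorm hn i), 1, H₃.one_mem,
      by group⟩

/-- `q ∈ H₁` normalising `N ≤ H₃`. -/
theorem no_design_of_split₃₁ (N : Subgroup (GLm p m)) (q : GLm p m) {r : ℕ} (hr : 2 ≤ r)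
    (hone : ∀ n ∈ N, ∀ i < r, (n : GLm p m) * q ^ i = 1 → i = 0)
    (htr : ∀ i < r, ∀ u : Fin m → ZMod p, ∃ n ∈ N,
      ((q ^ i : GLm p m) : Mat p m) *ᵥ u = ((n : GLm p m) : Mat p m) *ᵥ u)
    (hnorm : ∀ n ∈ N, q⁻¹ * n * q ∈ N) (hq : q ∈ H₁) (hN : N ≤ H₃) :
    ¬ ∃ c : Mat p m → ℂ, (∀ M, 1 < M.rank → c M = 0) ∧
      (∑ M, c M * ZMod.stdAddChar (Matrix.trace (M * ((1 : GLm p m) : Mat p m)))) = 1 ∧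
      ∀ a ∈ H₁, ∀ b ∈ H₂, ∀ g ∈ H₃, a * b * g ≠ 1 →
        (∑ M, c M * ZMod.stdAddChar (Matrix.trace (M * ((a * b * g : GLm p m) : Mat p m)))) = 0 :=
  no_design_of_split N q hr hone htr fun n hn i _ _ =>
    ⟨q ^ i, H₁.pow_mem hq i, 1, H₂.one_mem, (q ^ i)⁻¹ * n * q ^ i, hN (conj_pow_mem hnorm hn i),
      by group⟩

/-- `q ∈ H₂` normalising `N ≤ H₃`. -/
theorem no_design_of_split₃₂ (N : Subgroup (GLm p m)) (q : GLm p m) {r : ℕ} (hr : 2 ≤ r)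
    (hone : ∀ n ∈ N, ∀ i < r, (n : GLm p m) * q ^ i = 1 → i = 0)
    (htr : ∀ i < r, ∀ u : Fin m → ZMod p, ∃ n ∈ N,
      ((q ^ i : GLm p m) : Mat p m) *ᵥ u = ((n : GLm p m) : Mat p m) *ᵥ u)
    (hnorm : ∀ n ∈ N, q⁻¹ * n * q ∈ N) (hq : q ∈ H₂) (hN : N ≤ H₃) :
    ¬ ∃ c : Mat p m → ℂ, (∀ M, 1 < M.rank → c M = 0) ∧
      (∑ M, c M * ZMod.stdAddChar (Matrix.trace (M * ((1 : GLm p m) : Mat p m)))) = 1 ∧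
      ∀ a ∈ H₁, ∀ b ∈ H₂, ∀ g ∈ H₃, a * b * g ≠ 1 →
        (∑ M, c M * ZMod.stdAddChar (Matrix.trace (M * ((a * b * g : GLm p m) : Mat p m)))) = 0 :=
  no_design_of_split N q hr hone htr fun n hn i _ _ =>
    ⟨1, H₁.one_mem, q ^ i, H₂.pow_mem hq i, (q ^ i)⁻¹ * n * q ^ i, hN (conj_pow_mem hnorm hn i),
      by group⟩

end SplitFunctional
end Summit.MatrixMultiplication.MatrixMultiplication.Theorems.SubgroupIdentityDesigns.Negative
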